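import Literature.Barriers.Parity.LeastPrimeValue
import Literature.NumberTheory.Sieve.McCurleyCovering
import Mathlib.RingTheory.Polynomial.Eisenstein.Basic
import Mathlib.RingTheory.Ideal.Maximal
import Mathlib.Data.Nat.ChineseRemainder
import Mathlib.Data.Nat.Prime.Int
import Mathlib.NumberTheory.Primorial
import HarnessLib

/-!
# Proof of `Literature.Barriers.Parity.LeastPrimeValueBarrier` (McCurley 1986, Theorem 3)

Second companion ("Proofs") file of `Literature/Barriers/Parity/LeastPrimeValue.lean` (the first,
`LeastPrimeValueProofs.lean`, discharges `McCurley1986_noSmallPrimeValues`): the named fact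
`Literature.Barriers.Parity.LeastPrimeValueBarrier` — K. S. McCurley, *The smallest prime value of `xⁿ + a`*,
Can. J. Math. 38 (1986), Theorem 3: for every `n ≥ 1` there are `C(n) > 0` and infinitely many
`a` with `xⁿ + a` irreducible over `ℤ` and composite for all integers
`0 ≤ x ≤ C(n) (log a/log₃ a)(log₂ a log₄ a/log₃ a)^{d(n)}` — is DISCHARGED here
(`LeastPrimeValueBarrier_holds`), following §4 of the paper:

* the sieve (`Literature.NumberTheory.Sieve.McCurley.exists_powClasses_cover`): for large `w`, residues `c_p`,
  `p ≤ w` prime, with `mⁿ + c_p ≡ 0 (mod p)` for some `p ≤ w` whenever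
  `0 ≤ m ≤ α (w/log₂ w)(log w log₃ w/log₂ w)^{d(n)}`;
* "we choose `a` modulo `Q = q² ∏ p`, … `Q ≤ a < 2Q` and `a ≡ q (mod q²)`, so that `xⁿ + a` is
  irreducible" — the Chinese remainder theorem (Mathlib's `Nat.chineseRemainderOfFinset`) with a
  prime `w < q ≤ 2w` (Bertrand) and Eisenstein's criterion at `q`
  (`Polynomial.IsEisensteinAt.irreducible`); then every `mⁿ + a`, `m ≤ u`, has a prime factor
  `p ≤ w < a` and is composite;
* "it follows from the prime number theorem that `log a ∼ w`": here only
  `w/(6 log w) ≤ log a ≤ 2w` (from `π(w) ≥ w/(4 log w)` and `∏_{p ≤ w} p ≤ 4^w`, Chebyshev), which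
  gives `(log a/log₃ a)(log₂ a log₄ a/log₃ a)^{d} ≤ 4·8^d (w/log₂ w)(log w log₃ w/log₂ w)^{d}`
  (`mccurleyRankinBound_le`), so that `C(n) = α/(8·8^{d(n)})` works.

## References

* K. S. McCurley, Can. J. Math. 38 (1986) 925–936, Theorem 3, §4. [McCurley1986SmallestPrimeValue]
-/

open Finset Filter Real Polynomial

namespace Literature.Barriers.Parity

namespace McCurleyThm3

/-! ### The size of McCurley's range in terms of `w` -/

/-- **Bookkeeping with iterated logarithms.** With `L = log w` and `T = log L ≥ 19` (so
`T ≤ L/4`): if `w/(6 L) ≤ log a ≤ 2 w` then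
`(log a/log₃ a)(log₂ a · log₄ a/log₃ a)^d ≤ 4 · 8^d · (w/T)(L log T/T)^d`
(`log₂ a ∈ [L/2, 2L]`, `log₃ a ∈ [T/2, 2T]`, `0 ≤ log₄ a ≤ 2 log T`). [folklore] -/
theorem mccurleyRankinBound_le (n : ℕ) {w : ℕ} {L T : ℝ} (hL : L = Real.log w)
    (hT : T = Real.log L) (hT19 : 19 ≤ T) {a : ℝ}
    (ha1 : (w : ℝ) / (6 * L) ≤ Real.log a) (ha2 : Real.log a ≤ 2 * w) :
    mccurleyRankinBound n a ≤
      4 * 8 ^ numDivisors n * ((w : ℝ) / T * (L * Real.log T / T) ^ numDivisors n) := by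
  obtain ⟨hT0, hlogT1, hlogTT, hexpT, hL200, hexpL, hw200⟩ :=
    Literature.NumberTheory.Sieve.McCurley.basics hL hT hT19
  set d := numDivisors n with hd
  have hL0 : 0 < L := by linarith
  have hw0 : (0 : ℝ) < w := by linarith
  have hlog2 := Real.log_two_lt_d9
  have hlog2' := Real.log_two_gt_d9
  -- `T ≤ L/4`
  have hTL : T ≤ L / 4 := by
    have h1 : T ^ 2 / 2 ≤ L := by
      rw [← hexpT]
      have := Real.quadratic_le_exp_of_nonneg hT0.le
      nlinarith
    nlinarith
  -- `la = log a ∈ [w/(6L), 2w]`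
  set la := Real.log a with hla
  have hla0 : 0 < la := lt_of_lt_of_le (by positivity) ha1
  -- `l2 = log la ∈ [L/2, 2L]`
  set l2 := Real.log la with hl2
  have hlog6 : Real.log 6 ≤ 2 := by
    have : Real.log 6 ≤ Real.log (Real.exp 2) := by
      refine Real.log_le_log (by norm_num) ?_
      have h := Real.exp_one_gt_d9
      have h2 : Real.exp 2 = Real.exp 1 * Real.exp 1 := by rw [← Real.exp_add]; norm_num
      nlinarith
    rwa [Real.log_exp] at this
  have hl2lo : L / 2 ≤ l2 := by
    have h1 : Real.log ((w : ℝ) / (6 * L)) ≤ l2 := Real.log_le_log (by positivity) ha1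
    rw [Real.log_div hw0.ne' (by positivity), Real.log_mul (by norm_num) hL0.ne', ← hL, ← hT] at h1
    linarith
  have hl2hi : l2 ≤ 2 * L := by
    have h1 : l2 ≤ Real.log (2 * w) := Real.log_le_log hla0 ha2
    rw [Real.log_mul (by norm_num) hw0.ne', ← hL] at h1
    linarith
  have hl20 : 0 < l2 := by linarith
  -- `l3 = log l2 ∈ [T/2, 2T]`
  set l3 := Real.log l2 with hl3
  have hl3lo : T / 2 ≤ l3 := by
    have h1 : Real.log (L / 2) ≤ l3 := Real.log_le_log (by positivity) hl2lo
    rw [Real.log_div hL0.ne' (by norm_num), ← hT] at h1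
    linarith
  have hl3hi : l3 ≤ 2 * T := by
    have h1 : l3 ≤ Real.log (2 * L) := Real.log_le_log hl20 hl2hi
    rw [Real.log_mul (by norm_num) hL0.ne', ← hT] at h1
    linarith
  have hl30 : 0 < l3 := by linarith
  -- `l4 = log l3 ∈ [0, 2 log T]`
  set l4 := Real.log l3 with hl4
  have hl4lo : 0 ≤ l4 := Real.log_nonneg (by linarith)
  have hl4hi : l4 ≤ 2 * Real.log T := by
    have h1 : l4 ≤ Real.log (2 * T) := Real.log_le_log hl30 hl3hi
    rw [Real.log_mul (by norm_num) hT0.ne'] at h1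
    linarith
  -- the two factors
  have hA : la / l3 ≤ 4 * ((w : ℝ) / T) := by
    rw [div_le_iff₀ hl30]
    calc la ≤ 2 * w := ha2
      _ = 4 * ((w : ℝ) / T) * (T / 2) := by field_simp; ring
      _ ≤ 4 * ((w : ℝ) / T) * l3 := mul_le_mul_of_nonneg_left hl3lo (by positivity)
  have hB : l2 * l4 / l3 ≤ 8 * (L * Real.log T / T) := by
    rw [div_le_iff₀ hl30]
    have h1 : l2 * l4 ≤ (2 * L) * (2 * Real.log T) := mul_le_mul hl2hi hl4hi hl4lo (by linarith)
    calc l2 * l4 ≤ (2 * L) * (2 * Real.log T) := h1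
      _ = 8 * (L * Real.log T / T) * (T / 2) := by field_simp; ring
      _ ≤ 8 * (L * Real.log T / T) * l3 := mul_le_mul_of_nonneg_left hl3lo (by positivity)
  have hB0 : 0 ≤ l2 * l4 / l3 := by positivity
  rw [mccurleyRankinBound_eq]
  calc la / l3 * (l2 * l4 / l3) ^ d ≤ (4 * ((w : ℝ) / T)) * (8 * (L * Real.log T / T)) ^ d :=
        mul_le_mul hA (pow_le_pow_left₀ hB0 hB d) (by positivity) (by positivity)
    _ = 4 * 8 ^ d * ((w : ℝ) / T * (L * Real.log T / T) ^ d) := by rw [mul_pow]; ring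

/-! ### Eisenstein at `q` for `xⁿ + a`, `a ≡ q (mod q²)` -/

/-- `xⁿ + a` (`n ≥ 1`) is irreducible over `ℤ` when `q ∣ a` and `q² ∤ a` for a prime `q`
(Eisenstein's criterion; McCurley: "we choose `a ≡ q (mod q²)`, so that `xⁿ + a` is irreducible").
[cite: McCurley1986SmallestPrimeValue, §3 (p. 931)] -/
theorem irreducible_X_pow_add_C_of_eisenstein {n : ℕ} (hn : 1 ≤ n) {a q : ℕ} (hq : q.Prime)
    (hqa : q ∣ a) (hq2a : ¬ q ^ 2 ∣ a) : Irreducible (X ^ n + C (a : ℤ) : ℤ[X]) := by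
  have hn0 : n ≠ 0 := by omega
  set P : Ideal ℤ := Ideal.span {(q : ℤ)} with hP
  have hPprime : P.IsPrime :=
    Ideal.isPrime_span_singleton_of_prime (Nat.prime_iff_prime_int.1 hq)
  have hmonic : (X ^ n + C (a : ℤ) : ℤ[X]).Monic := monic_X_pow_add_C _ hn0
  have hdeg : (X ^ n + C (a : ℤ) : ℤ[X]).natDegree = n := natDegree_X_pow_add_C
  have hE : (X ^ n + C (a : ℤ) : ℤ[X]).IsEisensteinAt P := by
    refine ⟨?_, ?_, ?_⟩
    · rw [hmonic.leadingCoeff, hP, Ideal.mem_span_singleton]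
      intro h
      have : (q : ℤ) ≤ 1 := Int.le_of_dvd one_pos h
      have := hq.two_le
      omega
    · intro k hk
      rw [hdeg] at hk
      rw [coeff_add, coeff_X_pow, coeff_C, if_neg hk.ne, zero_add, hP, Ideal.mem_span_singleton]
      split_ifs with hk0
      · exact_mod_cast hqa
      · exact dvd_zero _
    · rw [coeff_add, coeff_X_pow, coeff_C, if_neg (by omega : (0 : ℕ) ≠ n), zero_add, if_pos rfl,
        hP, Ideal.span_singleton_pow, Ideal.mem_span_singleton]
      exact_mod_cast hq2a
  exact hE.irreducible hPprime hmonic.isPrimitive (by rw [hdeg]; omega)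

/-! ### The Chinese remainder step -/

/-- **CRT with the Eisenstein condition.** For prescribed residues `c p (mod p)`, `p ≤ w` prime,
and a prime `q > w` there is `a` with `a ≡ c p (mod p)` for every prime `p ≤ w`,
`a ≡ q (mod q²)`, and `Q ≤ a < 2Q` where `Q = q² ∏_{p ≤ w} p` (McCurley's choice of `a`).
[cite: McCurley1986SmallestPrimeValue, §§3–4 (pp. 931–932)] -/
theorem exists_crt_residues (c : ℕ → ℕ) {w q : ℕ} (hq : q.Prime) (hwq : w < q) :
    ∃ a : ℕ, (∀ p ∈ Nat.primesLE w, a ≡ c p [MOD p]) ∧ a ≡ q [MOD q ^ 2] ∧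
      q ^ 2 * primorial w ≤ a ∧ a < 2 * (q ^ 2 * primorial w) := by
  classical
  set t : Finset ℕ := insert q (Nat.primesLE w) with ht
  set s : ℕ → ℕ := fun i => if i = q then q ^ 2 else i with hs
  set r : ℕ → ℕ := fun i => if i = q then q else c i with hr
  have hqt : q ∉ Nat.primesLE w := fun h => by
    have := (Nat.mem_primesLE.1 h).1; omega
  have hmem : ∀ p ∈ Nat.primesLE w, p.Prime ∧ p ≠ q := fun p hp =>
    ⟨(Nat.mem_primesLE.1 hp).2, fun h => hqt (h ▸ hp)⟩
  have hs0 : ∀ i ∈ t, s i ≠ 0 := by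
    intro i hi
    rw [ht, mem_insert] at hi
    rcases hi with rfl | hi
    · simp [hs, hq.ne_zero]
    · have := hmem i hi
      simp [hs, this.2, this.1.ne_zero]
  have hpp : Set.Pairwise (t : Set ℕ) (Function.onFun Nat.Coprime s) := by
    intro i hi j hj hij
    rw [mem_coe, ht, mem_insert] at hi hj
    show Nat.Coprime (s i) (s j)
    rcases hi with rfl | hi <;> rcases hj with rfl | hj
    · exact absurd rfl hij
    · obtain ⟨hjp, hjq⟩ := hmem j hj
      simp only [hs, if_pos rfl, if_neg hjq]
      exact ((Nat.coprime_primes hq hjp).2 (Ne.symm hjq)).pow_left 2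
    · obtain ⟨hip, hiq⟩ := hmem i hi
      simp only [hs, if_pos rfl, if_neg hiq]
      exact ((Nat.coprime_primes hip hq).2 hiq).pow_right 2
    · obtain ⟨hip, hiq⟩ := hmem i hi
      obtain ⟨hjp, hjq⟩ := hmem j hj
      simp only [hs, if_neg hiq, if_neg hjq]
      exact (Nat.coprime_primes hip hjp).2 hij
  set a₀ := Nat.chineseRemainderOfFinset r s t hs0 hpp with ha₀
  have hQ : ∏ i ∈ t, s i = q ^ 2 * primorial w := by
    rw [ht, prod_insert hqt, primorial_eq_prod_primesLE]
    simp only [hs, if_pos rfl]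
    congr 1
    exact prod_congr rfl fun p hp => if_neg (hmem p hp).2
  have hlt : (a₀ : ℕ) < q ^ 2 * primorial w := by
    rw [← hQ]; exact Nat.chineseRemainderOfFinset_lt_prod r s hs0 hpp
  set Q := q ^ 2 * primorial w with hQdef
  refine ⟨a₀ + Q, fun p hp => ?_, ?_, by omega, by omega⟩
  · have h1 : (a₀ : ℕ) ≡ r p [MOD s p] := a₀.2 p (by rw [ht]; exact mem_insert_of_mem hp)
    simp only [hr, hs, if_neg (hmem p hp).2] at h1
    have hdvd : p ∣ Q := by
      rw [hQdef, primorial_eq_prod_primesLE]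
      exact Dvd.dvd.mul_left (dvd_prod_of_mem _ hp) _
    calc (a₀ : ℕ) + Q ≡ c p + 0 [MOD p] := Nat.ModEq.add h1 (Nat.modEq_zero_iff_dvd.2 hdvd)
      _ = c p := add_zero _
  · have h1 : (a₀ : ℕ) ≡ r q [MOD s q] := a₀.2 q (by rw [ht]; exact mem_insert_self _ _)
    simp only [hr, hs, if_pos rfl] at h1
    have hdvd : q ^ 2 ∣ Q := Dvd.intro _ rfl
    calc (a₀ : ℕ) + Q ≡ q + 0 [MOD q ^ 2] := Nat.ModEq.add h1 (Nat.modEq_zero_iff_dvd.2 hdvd)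
      _ = q := add_zero _

end McCurleyThm3

open McCurleyThm3

/-! ### The theorem -/

/-- **McCurley's Theorem 3, proved** (discharging the named fact `LeastPrimeValueBarrier`): for
every `n ≥ 1` there are `C(n) > 0` and infinitely many `a` such that `xⁿ + a` is irreducible over
`ℤ` and `xⁿ + a` is composite for all integers `0 ≤ x ≤ C(n) (log a/log₃ a)(log₂ a log₄ a/log₃ a)^{d(n)}`.
[cite: McCurley1986SmallestPrimeValue, Theorem 3 (p. 927) and §4 (pp. 932–934)] -/
theorem LeastPrimeValueBarrier_holds : LeastPrimeValueBarrier := by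
  classical
  intro n hn
  obtain ⟨α, hα0, hcover⟩ := Literature.NumberTheory.Sieve.McCurley.exists_powClasses_cover hn
  have hdn : #n.divisors = numDivisors n := rfl
  rw [hdn] at hcover
  set d := numDivisors n with hd
  refine ⟨α / (8 * 8 ^ d), by positivity, ?_⟩
  rw [Filter.frequently_atTop]
  intro N
  obtain ⟨w, ⟨c, hc⟩, ⟨hT19, -, -, -, -, hπ⟩, hwN⟩ :=
    (hcover.and ((Literature.NumberTheory.Sieve.McCurley.eventually_loglog d).and
      (eventually_ge_atTop N))).exists
  -- notation and basic sizes
  set L : ℝ := Real.log (w : ℝ) with hL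
  set T : ℝ := Real.log L with hT
  obtain ⟨hT0, hlogT1, hlogTT, hexpT, hL200, hexpL, hw200⟩ :=
    Literature.NumberTheory.Sieve.McCurley.basics hL hT hT19
  have hL0 : 0 < L := by linarith
  have hw0r : (0 : ℝ) < w := by linarith
  have hw200' : 200 ≤ w := by exact_mod_cast hw200
  set F : ℝ := (w : ℝ) / T * (L * Real.log T / T) ^ d with hF
  have hFpos : 0 < F := by positivity
  -- the prime `q ∈ (w, 2w]` and the integer `a`
  obtain ⟨q, hq, hwq, hq2w⟩ := Nat.exists_prime_lt_and_le_two_mul w (by omega)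
  obtain ⟨a, hac, haq, hQa, ha2Q⟩ := exists_crt_residues c hq hwq
  set Q := q ^ 2 * primorial w with hQ
  -- `q ∣ a`, `q² ∤ a`
  have hq1 : 1 < q := hq.one_lt
  have hqq : q < q ^ 2 := by nlinarith
  have hqa : q ∣ a := by
    have h1 : a % q ^ 2 = q := by
      rw [haq, Nat.mod_eq_of_lt hqq]
    have h2 := Nat.div_add_mod a (q ^ 2)
    refine ⟨q * (a / q ^ 2) + 1, ?_⟩
    calc a = q ^ 2 * (a / q ^ 2) + a % q ^ 2 := h2.symm
      _ = q * (q * (a / q ^ 2) + 1) := by rw [h1]; ring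
  have hq2a : ¬ q ^ 2 ∣ a := by
    intro h
    have h1 : a % q ^ 2 = 0 := Nat.mod_eq_zero_of_dvd h
    have h2 : a % q ^ 2 = q % q ^ 2 := haq
    rw [Nat.mod_eq_of_lt hqq] at h2
    omega
  have hirr : Irreducible (X ^ n + C (a : ℤ) : ℤ[X]) :=
    irreducible_X_pow_add_C_of_eisenstein hn hq hqa hq2a
  -- the size of `a`: `w < Q ≤ a < 2Q ≤ 2 (2w)² 4^w`, `Q ≥ ∏_{p ≤ w} p ≥ 2^{π(w)}`
  have hQpos : 0 < Q := Nat.mul_pos (pow_pos hq.pos 2) (primorial_pos w)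
  have hwQ : w < Q := by
    calc w < q := hwq
      _ ≤ q ^ 2 := by nlinarith
      _ ≤ q ^ 2 * primorial w := Nat.le_mul_of_pos_right _ (primorial_pos w)
  have ha0 : (0 : ℝ) < a := by exact_mod_cast lt_of_lt_of_le hQpos hQa
  have hlog2 := Real.log_two_gt_d9
  have hlog2' := Real.log_two_lt_d9
  have hloga_lo : (w : ℝ) / (6 * L) ≤ Real.log a := by
    have hprim : (2 : ℝ) ^ Nat.primeCounting w ≤ primorial w := by
      have h1 : ∏ _p ∈ Nat.primesLE w, (2 : ℕ) ≤ ∏ p ∈ Nat.primesLE w, p :=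
        prod_le_prod (fun p _ => Nat.zero_le _) fun p hp => (Nat.mem_primesLE.1 hp).2.two_le
      rw [prod_const, Nat.primesLE_card_eq_primeCounting, ← primorial_eq_prod_primesLE] at h1
      exact_mod_cast h1
    have h1 : (primorial w : ℝ) ≤ a := by
      have : primorial w ≤ a := le_trans (Nat.le_mul_of_pos_left _ (by positivity)) hQa
      exact_mod_cast this
    have h3 : (Nat.primeCounting w : ℝ) * Real.log 2 ≤ Real.log a := by
      have := Real.log_le_log (by positivity) (hprim.trans h1)
      rwa [Real.log_pow] at this
    have hπ' : (w : ℝ) / (4 * L) ≤ Nat.primeCounting w := by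
      have : (0 : ℝ) ≤ Nat.primeCounting (w / 4) := Nat.cast_nonneg _
      linarith [hπ]
    have hl2 : (0 : ℝ) ≤ Real.log 2 := by linarith
    have h4 : (w : ℝ) / (4 * L) * Real.log 2 ≤ Real.log a :=
      le_trans (mul_le_mul_of_nonneg_right hπ' hl2) h3
    have h5' : (w : ℝ) / (6 * L) ≤ (w : ℝ) / (4 * L) * Real.log 2 := by
      rw [div_mul_eq_mul_div, div_le_div_iff₀ (by positivity) (by positivity)]
      nlinarith [mul_pos hw0r hL0]
    linarith
  have hloga_hi : Real.log a ≤ 2 * w := by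
    have h1 : (a : ℝ) ≤ 2 * ((2 * w) ^ 2 * 4 ^ w) := by
      have : a ≤ 2 * ((2 * w) ^ 2 * 4 ^ w) := by
        calc a ≤ 2 * Q := ha2Q.le
          _ ≤ 2 * ((2 * w) ^ 2 * 4 ^ w) := by
              apply Nat.mul_le_mul_left
              exact Nat.mul_le_mul (Nat.pow_le_pow_left hq2w 2) (primorial_le_four_pow w)
      exact_mod_cast this
    have h2 : Real.log a ≤ Real.log (2 * ((2 * (w : ℝ)) ^ 2 * 4 ^ w)) := Real.log_le_log ha0 h1
    have h3 : Real.log (2 * ((2 * (w : ℝ)) ^ 2 * 4 ^ w)) =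
        Real.log 2 + 2 * (Real.log 2 + L) + w * Real.log 4 := by
      rw [Real.log_mul (by norm_num) (by positivity), Real.log_mul (by positivity) (by positivity),
        Real.log_pow, Real.log_pow, Real.log_mul (by norm_num) hw0r.ne', ← hL]
      push_cast
      ring
    have hlog4 : Real.log 4 ≤ 1.4 := by
      have h4 : Real.log 4 = 2 * Real.log 2 := by
        rw [show (4 : ℝ) = 2 ^ 2 by norm_num, Real.log_pow]; ring
      rw [h4]; linarith
    -- `L ≤ w/100` since `w = exp L ≥ L²/2 ≥ 100 L`
    have hLw : L ≤ (w : ℝ) / 100 := by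
      rw [← hexpL]
      have := Real.quadratic_le_exp_of_nonneg hL0.le
      rw [le_div_iff₀ (by norm_num)]
      nlinarith
    rw [h3] at h2
    have hw0 : (0 : ℝ) ≤ w := hw0r.le
    nlinarith [mul_le_mul_of_nonneg_left hlog4 hw0]
  -- McCurley's range at `a` is within `α F`
  have hMRB : mccurleyRankinBound n a ≤ 4 * 8 ^ d * F :=
    mccurleyRankinBound_le n hL hT hT19 hloga_lo hloga_hi
  refine ⟨a, ?_, hirr, fun x hx => ?_⟩
  · -- `N ≤ a`
    have : N < a := by omega
    exact this.le
  · have hxF : (x : ℝ) ≤ α * F := by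
      have h8 : (0 : ℝ) < 8 * 8 ^ d := by positivity
      calc (x : ℝ) ≤ α / (8 * 8 ^ d) * mccurleyRankinBound n a := hx
        _ ≤ α / (8 * 8 ^ d) * (4 * 8 ^ d * F) :=
            mul_le_mul_of_nonneg_left hMRB (div_nonneg hα0.le h8.le)
        _ = α * F / 2 := by field_simp; ring
        _ ≤ α * F := by linarith [mul_pos hα0 hFpos]
    obtain ⟨p, hp, hpw, hdvd⟩ := hc x hxF
    have hpa : a ≡ c p [MOD p] := hac p (Nat.mem_primesLE.2 ⟨hpw, hp⟩)
    have hdvd' : p ∣ x ^ n + a := by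
      have h1 : x ^ n + a ≡ x ^ n + c p [MOD p] := Nat.ModEq.add_left _ hpa
      exact Nat.modEq_zero_iff_dvd.1 (h1.trans (Nat.modEq_zero_iff_dvd.2 hdvd))
    refine ⟨by omega, fun hprime => ?_⟩
    have := (Nat.prime_dvd_prime_iff_eq hp hprime).1 hdvd'
    omega

end Literature.Barriers.Parity
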